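import Summits.SmoothPoincare4.SmoothPoincare4.Theorems.CylinderEntropyCylinderRungTwoKillingFluxDefs
import Summits.SmoothPoincare4.SmoothPoincare4.Theorems.CylinderEntropyCylinderRungTwoEpsilonRegularityOfWhite
import Summits.SmoothPoincare4.SmoothPoincare4.Theorems.CylinderEntropyCylinderRungTwoDissipationBudget
import Summits.SmoothPoincare4.SmoothPoincare4.Theorems.CylinderEntropyCylinderRungTwoAreaToFloorOfQuantization
import Summits.SmoothPoincare4.SmoothPoincare4.Theorems.CylinderEntropyCylinderRungTwoTiltExcessVanishing
import HarnessLib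

/-!
# Route `CylinderEntropy`, item `ImmortalAreaToFloor` (stmt-SmoothPoincare4-17197):
# the ALLARD-FREE reduction — area to the floor from ONE static, flow-free, entropy-using lemma

The item (route-choice 2026-08-16) is AREA TO THE FLOOR ALONG IMMORTAL THIN CYLINDER FLOWS: along an
immortal smooth mean curvature flow `IsCylinderMCF M F ν T` of a compact connected cross-section of
`N = S⁴ × ℝ ⊂ ℝ⁶`, every slice separating the ends with cylinder entropy `λ_cyl < 2`, some slice has area
`μH⁴(F_t(M)) ≤ (1 + ε) μH⁴(S⁴)`.  The landed reduction `…ImmortalAreaToFloorReduction.lean` routes it through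
the route's crux `AreaQuantization` (stmt-SmoothPoincare4-17175: area limits of almost-stationary slab-confined
cross-sections lie in `ℕ · vol`) — Allard's integral compactness theorem in disguise, which does NOT use the
entropy bound and is sharp (`m = 2, 3` occur).  This file PROVES a second, strictly cheaper reduction which
keeps the entropy bound in play:

* `IsCylinderMCF.exists_cylEntropy_le_ofReal_two_sub` — the cylinder entropy is non-increasing along the
  flow (landed `IsCylinderMCF.cylEntropy_range_le_of_le`, from Hamilton's monotonicity), hence the hypothesis
  `λ_cyl(F_T) < 2` at the INITIAL time alone gives a UNIFORM GAP `λ_cyl(F_t) ≤ 2 - δ` (`δ > 0`) for all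
  `t ≥ T`;
* `areaToFloor_of_areaNearFloorOfSmallTilt` — **the item follows from the static lemma
  "TILT-SMALL THIN CROSS-SECTIONS HAVE AREA NEAR THE FLOOR"**: for every `δ > 0`, height bound `B` and
  `η > 0` there is `ε > 0` such that every compact connected embedded separating cross-section `ι : M → N`
  with smooth unit normal `ν` tangent to `N`, `|z₅| ≤ B`, `λ_cyl(ι M) ≤ 2 - δ` and TILT EXCESS
  `∫ (1 - ν₅²) d(ι^*μH⁴) ≤ ε` has `μH⁴(ι M) ≤ (1 + η) μH⁴(S⁴)`.  Proof of the reduction, over landed theorems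
  only: the uniform gap above; the uniform height bound (`IsCylinderMCF.exists_height_bound`, slab
  confinement); the dissipation budget (`stub_dissipationBudget`) yields good times `r_n → ∞` with
  `∫ ‖∂_r F‖² = ∫ H² → 0` while the (antitone, `< 2 vol`) areas converge; along them the tilt excess tends
  to `0` (`tendsto_lintegral_tiltExcess_comap`, the landed first-variation identity `∫ (1-ν₅²) = ∫ H z₅ ν₅`),
  so some good time has tilt `≤ ε` and the static lemma applies to that slice;
* `immortalAreaToFloor_of_areaNearFloorOfSmallTilt` — the same with the item's statement UNFOLDED verbatim
  (the eight flow hypotheses are the fields of `IsCylinderMCF`; `SeparatesEnds`, `cylEntropy` unfold by `rfl`).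

So the item's residual is the static lemma, in which the entropy gap `2 - δ` is load-bearing at SMALL scales
(two nearly coincident sheets over a ball `D_s` have typed density `≈ 2(1 - o(1)) > 2 - δ` at scale `s/L(δ)`),
the separation only through the flux identity `|∫ ν₅ dμ| = vol S⁴` (landed `stub_fluxIdentity`), and no
varifold compactness / integrality is needed: area `- vol = ∫ (1 - |ν₅|) + ∫ (|ν₅| - ν₅)`, the first term is
`≤` tilt, and the second ("cancelling sheets") is shown small by a covering argument at the thickness scale of
the cancelling sheets (evidence `ANALYSIS-prover-17197-c1.md` on the item).  Nothing here is conditional: no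
`sorry`, no new definition, no named fact.

References: R. S. Hamilton, *Monotonicity formulas for parabolic flows on manifolds*, Comm. Anal. Geom. 1
(1993) 127–137, Thm. 4.1; T. H. Colding, W. P. Minicozzi II, *Generic mean curvature flow I*, Ann. of Math.
175 (2012), Lemma 1.11 (entropy is non-increasing under the flow); K. Brakke, *The motion of a surface by its
mean curvature* (1978), §3 (area as a Lyapunov function).
-/

noncomputable section

-- the prescribed namespace `Summit.SmoothPoincare4.SmoothPoincare4.…` repeats `SmoothPoincare4`
set_option linter.dupNamespace false

open MeasureTheory Set Filter
open scoped Manifold ContDiff ENNReal Topology BigOperators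

namespace Summit.SmoothPoincare4.SmoothPoincare4.Cruxes.CylinderRungTwo.KillingFlux

open Literature.Geometry.Riemannian
open Literature.Geometry.Lorentzian Literature.Geometry.Lorentzian.PseudoRiemannianMetric
open Literature.Geometry.Riemannian.SphericalCylinderEntropy

section Flow

variable {M : Type} [TopologicalSpace M] [ChartedSpace (EuclideanSpace ℝ (Fin 4)) M]
  [IsManifold (𝓡 4) ∞ M] [T2Space M] [CompactSpace M]
  {F ν : ℝ → M → EuclideanSpace ℝ (Fin 6)} {T : ℝ}

/-- **Uniform entropy gap along the flow**: if the initial slice has `λ_cyl(F_T(M)) < 2`, then there is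
`δ > 0` with `λ_cyl(F_t(M)) ≤ 2 - δ` for ALL `t ≥ T` (the initial entropy is finite, `δ := 2 - λ_cyl(F_T(M))`,
and the entropy is non-increasing along the flow by Hamilton's monotonicity, landed
`IsCylinderMCF.cylEntropy_range_le_of_le`).
[cite: ColdingMinicozzi2012, Lemma 1.11] -/
theorem IsCylinderMCF.exists_cylEntropy_le_ofReal_two_sub (hF : IsCylinderMCF M F ν T)
    (hT : cylEntropy (Set.range (F T)) < 2) :
    ∃ δ : ℝ, 0 < δ ∧ ∀ t, T ≤ t → cylEntropy (Set.range (F t)) ≤ ENNReal.ofReal (2 - δ) := by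
  have htop : cylEntropy (Set.range (F T)) ≠ ⊤ := ne_top_of_lt hT
  have h2top : (2 : ℝ≥0∞) ≠ ⊤ := ENNReal.ofNat_ne_top
  set l : ℝ := (cylEntropy (Set.range (F T))).toReal with hl
  have hl2 : l < 2 := by
    have h := (ENNReal.toReal_lt_toReal htop h2top).2 hT
    rwa [ENNReal.toReal_ofNat] at h
  refine ⟨2 - l, by linarith, fun t ht => ?_⟩
  calc cylEntropy (Set.range (F t)) ≤ cylEntropy (Set.range (F T)) := hF.cylEntropy_range_le_of_le le_rfl ht
    _ = ENNReal.ofReal l := (ENNReal.ofReal_toReal htop).symm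
    _ = ENNReal.ofReal (2 - (2 - l)) := by rw [sub_sub_cancel]

end Flow

/-- **Area to the floor from the static lemma "tilt-small thin cross-sections have area near the floor"**
(the Allard-free reduction of item `ImmortalAreaToFloor`, stmt-SmoothPoincare4-17197, in the folded
`IsCylinderMCF` / `SeparatesEnds` / `cylEntropy` vocabulary).  Hypothesis `hstatic`: for every entropy gap
`δ > 0`, height bound `B` and `η > 0` there is a tilt threshold `ε > 0` such that every compact connected
embedded separating cross-section `ι : M → N` with smooth unit normal `ν` tangent to `N`, `|z₅| ≤ B`,
`λ_cyl(ι M) ≤ 2 - δ` and `∫ (1 - ν₅²) d(ι^*μH⁴) ≤ ε` has `μH⁴(ι M) ≤ (1 + η) μH⁴(S⁴)`.  Conclusion: along every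
immortal cylinder flow of a compact connected cross-section with separating slices of entropy `< 2`, some
slice has area `≤ (1 + η) μH⁴(S⁴)`.  Proof: uniform gap (`exists_cylEntropy_le_ofReal_two_sub`), uniform
height bound (`exists_height_bound`), good times from the dissipation budget (`stub_dissipationBudget`,
`exists_lt_of_setLIntegral_le`) with `∫ H² → 0` (`norm_deriv_sq`) and convergent areas (antitone, `< 2 vol`),
tilt excess `→ 0` along them (`tendsto_lintegral_tiltExcess_comap`), and `hstatic` at a good time with tilt
`≤ ε`. [cite: Hamilton1993, Thm. 4.1] [cite: Brakke1978, §3] -/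
theorem areaToFloor_of_areaNearFloorOfSmallTilt
    (hstatic : ∀ δ : ℝ, 0 < δ → ∀ B η : ℝ, 0 < η → ∃ ε : ℝ, 0 < ε ∧
      ∀ (M : Type) [TopologicalSpace M] [T2Space M] [SecondCountableTopology M]
        [ChartedSpace (EuclideanSpace ℝ (Fin 4)) M] [IsManifold (𝓡 4) ∞ M] [CompactSpace M]
        [ConnectedSpace M] [MeasurableSpace M] [BorelSpace M]
        (ι ν : M → EuclideanSpace ℝ (Fin 6)),
        Manifold.IsSmoothEmbedding (𝓡 4) (𝓡 6) ∞ ι →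
        (∀ x, ∑ i : Fin 5, ι x (Fin.castSucc i) ^ 2 = 1) →
        SeparatesEnds (Set.range ι) →
        (euclideanMetric (EuclideanSpace ℝ (Fin 6))).IsSpacelikeImmersion (𝓡 4) ι →
        (euclideanMetric (EuclideanSpace ℝ (Fin 6))).IsUnitNormal (𝓡 4) ι ν 1 →
        (∀ x, ∑ i : Fin 5, ν x (Fin.castSucc i) * ι x (Fin.castSucc i) = 0) →
        ContMDiff (𝓡 4) (𝓡 6) ∞ ν →
        (∀ x, |ι x 5| ≤ B) →
        cylEntropy (Set.range ι) ≤ ENNReal.ofReal (2 - δ) →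
        ∫⁻ x, ENNReal.ofReal (1 - ν x 5 ^ 2)
            ∂(Measure.comap ι (μH[4] : Measure (EuclideanSpace ℝ (Fin 6)))) ≤ ENNReal.ofReal ε →
        μH[4] (Set.range ι) ≤
          ENNReal.ofReal (1 + η) * μH[4] (Metric.sphere (0 : EuclideanSpace ℝ (Fin 5)) 1)) :
    ∀ (M : Type) [TopologicalSpace M] [T2Space M] [SecondCountableTopology M]
      [ChartedSpace (EuclideanSpace ℝ (Fin 4)) M] [IsManifold (𝓡 4) ∞ M] [CompactSpace M]
      [ConnectedSpace M]
      (F : ℝ → M → EuclideanSpace ℝ (Fin 6)) (ν : ℝ → M → EuclideanSpace ℝ (Fin 6)) (T : ℝ),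
      IsCylinderMCF M F ν T →
      (∀ t, T ≤ t → SeparatesEnds (Set.range (F t))) →
      (∀ t, T ≤ t → cylEntropy (Set.range (F t)) < 2) →
      ∀ ε : ℝ, 0 < ε → ∃ t : ℝ, T ≤ t ∧
        μH[4] (Set.range (F t)) ≤
          ENNReal.ofReal (1 + ε) * μH[4] (Metric.sphere (0 : EuclideanSpace ℝ (Fin 5)) 1) := by
  intro M _ _ _ _ _ _ _ F ν T hflow hsep hent η hη
  -- Borel structure on `M` (the budget and the static lemma are stated for Borel cross-sections)
  letI : MeasurableSpace M := borel M
  haveI : BorelSpace M := ⟨rfl⟩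
  -- uniform entropy gap, uniform height bound, and the static threshold
  obtain ⟨δ, hδ, hgap⟩ := hflow.exists_cylEntropy_le_ofReal_two_sub (hent T le_rfl)
  obtain ⟨B, hB⟩ := hflow.exists_height_bound
  obtain ⟨ε₁, hε₁, hstat⟩ := hstatic δ hδ B η hη
  -- the areas: antitone, finite
  set V : ℝ≥0∞ := μH[4] (Metric.sphere (0 : EuclideanSpace ℝ (Fin 5)) 1) with hV
  set a : ℝ → ℝ≥0∞ := fun t => μH[4] (Set.range (F t)) with ha
  set Ainf : ℝ≥0∞ := ⨅ t ∈ Set.Ici T, a t with hAinf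
  have haT : a T < 2 * V := hflow.measure_range_lt_two_mul le_rfl (hent T le_rfl)
  have haTtop : a T ≠ ⊤ := ne_top_of_lt haT
  have hanti : AntitoneOn a (Set.Ici T) := stub_areaDissipation M F ν T hflow
  have hAinf_le : ∀ t, T ≤ t → Ainf ≤ a t := fun t ht => iInf₂_le t (Set.mem_Ici.2 ht)
  have hAinf_top : Ainf < ⊤ := lt_of_le_of_lt (hAinf_le T le_rfl) (lt_top_iff_ne_top.2 haTtop)
  -- the speed integral and its budget
  set f : ℝ → ℝ≥0∞ := fun r => ∫⁻ x, ENNReal.ofReal (‖deriv (fun s => F s x) r‖ ^ 2)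
      ∂(Measure.comap (F r) (μH[4] : Measure (EuclideanSpace ℝ (Fin 6)))) with hf
  have hbudget : ∀ t, T ≤ t → ∫⁻ r in Set.Icc T t, f r ≤ a T := fun t ht =>
    le_trans le_self_add (stub_dissipationBudget M F ν T hflow t ht)
  -- small speed at arbitrarily late times
  have hsmall : ∀ n : ℕ, ∃ r : ℝ, T + n ≤ r ∧ f r < ENNReal.ofReal (1 / ((n : ℝ) + 1)) := by
    intro n
    refine exists_lt_of_setLIntegral_le (t₀ := T + n) haTtop (fun L hL => ?_) (by positivity)
    have hn : (0 : ℝ) ≤ n := Nat.cast_nonneg n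
    calc ∫⁻ r in Set.Icc (T + n) (T + n + L), f r ≤ ∫⁻ r in Set.Icc T (T + n + L), f r :=
          lintegral_mono_set (Set.Icc_subset_Icc_left (by linarith))
      _ ≤ a T := hbudget _ (by linarith)
  choose r hrT hrf using hsmall
  have hr : ∀ n, T ≤ r n := fun n =>
    le_trans (le_add_of_nonneg_right (Nat.cast_nonneg n)) (hrT n)
  -- `f (r n) → 0`
  have hf0 : Tendsto (fun n => f (r n)) atTop (𝓝 0) := by
    have h1 : Tendsto (fun n : ℕ => ENNReal.ofReal (1 / ((n : ℝ) + 1))) atTop (𝓝 0) := by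
      rw [← ENNReal.ofReal_zero]
      exact ENNReal.tendsto_ofReal tendsto_one_div_add_atTop_nhds_zero_nat
    exact tendsto_of_tendsto_of_tendsto_of_le_of_le tendsto_const_nhds h1 (fun _ => bot_le)
      fun n => (hrf n).le
  -- `a (r n) → Ainf`
  have hrtop : Tendsto r atTop atTop := by
    refine tendsto_atTop_mono hrT ?_
    exact tendsto_atTop_add_const_left _ _ tendsto_natCast_atTop_atTop
  have haA : Tendsto (fun n => a (r n)) atTop (𝓝 Ainf) := by
    refine tendsto_order.2 ⟨fun b hb => Eventually.of_forall fun n => lt_of_lt_of_le hb (hAinf_le _ (hr n)),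
      fun b hb => ?_⟩
    obtain ⟨t₁, ht₁⟩ := iInf_lt_iff.1 hb
    obtain ⟨hT₁, hlt₁⟩ := iInf_lt_iff.1 ht₁
    filter_upwards [hrtop.eventually_ge_atTop t₁] with n hn
    exact lt_of_le_of_lt (hanti hT₁ (Set.mem_Ici.2 (hr n)) hn) hlt₁
  -- `∫ H² d((F (r n))^* μH⁴) → 0`
  have hH0 : Tendsto (fun n => ∫⁻ x, ENNReal.ofReal
      ((euclideanMetric (EuclideanSpace ℝ (Fin 6))).meanCurvature (F (r n)) contMDiff_pullbackBilin_holds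
        (hflow.isSpacelikeImmersion (r n) (hr n)) (ν (r n)) x ^ 2)
      ∂(Measure.comap (F (r n)) (μH[4] : Measure (EuclideanSpace ℝ (Fin 6))))) atTop (𝓝 0) := by
    refine hf0.congr fun n => ?_
    simp only [hf]
    refine lintegral_congr fun x => ?_
    rw [hflow.norm_deriv_sq (hr n) x]
  -- the tilt excess tends to `0` along the good times
  have htilt : Tendsto (fun n => ∫⁻ x, ENNReal.ofReal (1 - ν (r n) x 5 ^ 2)
      ∂(Measure.comap (F (r n)) (μH[4] : Measure (EuclideanSpace ℝ (Fin 6))))) atTop (𝓝 0) :=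
    tendsto_lintegral_tiltExcess_comap (fun n => (hflow.isSmoothEmbedding (r n) (hr n)).isEmbedding.injective)
      (fun n => hflow.isSpacelikeImmersion (r n) (hr n)) (fun n => hflow.contMDiff_normal (r n) (hr n))
      (fun n => hflow.isUnitNormal (r n) (hr n)) (fun n x => hflow.mem_cyl (r n) (hr n) x)
      (fun n x => hflow.normal_tangent (r n) (hr n) x) (fun n x => hB (r n) (hr n) x) hH0 hAinf_top haA
  -- a good time with tilt `< ε₁`
  have hev : ∀ᶠ n in atTop, ∫⁻ x, ENNReal.ofReal (1 - ν (r n) x 5 ^ 2)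
      ∂(Measure.comap (F (r n)) (μH[4] : Measure (EuclideanSpace ℝ (Fin 6)))) < ENNReal.ofReal ε₁ :=
    (tendsto_order.1 htilt).2 _ (ENNReal.ofReal_pos.2 hε₁)
  obtain ⟨n, hn⟩ := hev.exists
  exact ⟨r n, hr n, hstat M (F (r n)) (ν (r n)) (hflow.isSmoothEmbedding _ (hr n))
    (hflow.mem_cyl _ (hr n)) (hsep _ (hr n)) (hflow.isSpacelikeImmersion _ (hr n))
    (hflow.isUnitNormal _ (hr n)) (hflow.normal_tangent _ (hr n)) (hflow.contMDiff_normal _ (hr n))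
    (hB _ (hr n)) (hgap _ (hr n)) hn.le⟩

end Summit.SmoothPoincare4.SmoothPoincare4.Cruxes.CylinderRungTwo.KillingFlux

namespace Summit.SmoothPoincare4.SmoothPoincare4.Theorems

open Literature.Geometry.Riemannian
open Literature.Geometry.Lorentzian Literature.Geometry.Lorentzian.PseudoRiemannianMetric
open Literature.Geometry.Riemannian.SphericalCylinderEntropy (cylEntropy)
open Summit.SmoothPoincare4.SmoothPoincare4.Cruxes.CylinderRungTwo.KillingFlux

/-- **The item `ImmortalAreaToFloor` (stmt-SmoothPoincare4-17197) AS TYPED, from the static lemma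
"tilt-small thin cross-sections have area near the floor"** (`areaToFloor_of_areaNearFloorOfSmallTilt` with
the item's statement unfolded: the eight flow hypotheses of the item are exactly the fields of
`IsCylinderMCF M F ν T`, the separation hypothesis is `SeparatesEnds (Set.range (F t))` and the entropy
hypothesis is `cylEntropy (Set.range (F t)) < 2`, both by `rfl`).  This is the Allard-free residual of the
item: unlike `AreaQuantization` (stmt-SmoothPoincare4-17175) the static lemma keeps the entropy gap and asks
for no integrality of limits. [cite: Hamilton1993, Thm. 4.1] [cite: Brakke1978, §3] -/
theorem immortalAreaToFloor_of_areaNearFloorOfSmallTilt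
    (hstatic : ∀ δ : ℝ, 0 < δ → ∀ B η : ℝ, 0 < η → ∃ ε : ℝ, 0 < ε ∧
      ∀ (M : Type) [TopologicalSpace M] [T2Space M] [SecondCountableTopology M]
        [ChartedSpace (EuclideanSpace ℝ (Fin 4)) M] [IsManifold (𝓡 4) ∞ M] [CompactSpace M]
        [ConnectedSpace M] [MeasurableSpace M] [BorelSpace M]
        (ι ν : M → EuclideanSpace ℝ (Fin 6)),
        Manifold.IsSmoothEmbedding (𝓡 4) (𝓡 6) ∞ ι →
        (∀ x, ∑ i : Fin 5, ι x (Fin.castSucc i) ^ 2 = 1) →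
        SeparatesEnds (Set.range ι) →
        (euclideanMetric (EuclideanSpace ℝ (Fin 6))).IsSpacelikeImmersion (𝓡 4) ι →
        (euclideanMetric (EuclideanSpace ℝ (Fin 6))).IsUnitNormal (𝓡 4) ι ν 1 →
        (∀ x, ∑ i : Fin 5, ν x (Fin.castSucc i) * ι x (Fin.castSucc i) = 0) →
        ContMDiff (𝓡 4) (𝓡 6) ∞ ν →
        (∀ x, |ι x 5| ≤ B) →
        cylEntropy (Set.range ι) ≤ ENNReal.ofReal (2 - δ) →
        ∫⁻ x, ENNReal.ofReal (1 - ν x 5 ^ 2)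
            ∂(Measure.comap ι (μH[4] : Measure (EuclideanSpace ℝ (Fin 6)))) ≤ ENNReal.ofReal ε →
        μH[4] (Set.range ι) ≤
          ENNReal.ofReal (1 + η) * μH[4] (Metric.sphere (0 : EuclideanSpace ℝ (Fin 5)) 1)) :
    (haveI : (Literature.Geometry.Riemannian.euclideanMetric (EuclideanSpace ℝ (Fin 6))).HasLeviCivita := Literature.Geometry.Riemannian.instHasLeviCivitaEuclideanMetric; ∀ (M : Type) [TopologicalSpace M] [T2Space M] [SecondCountableTopology M] [ChartedSpace (EuclideanSpace ℝ (Fin 4)) M] [IsManifold (𝓡 4) ∞ M] [CompactSpace M] [ConnectedSpace M] (F : ℝ → M → EuclideanSpace ℝ (Fin 6)) (ν : ℝ → M → EuclideanSpace ℝ (Fin 6)) (T : ℝ), (∃ U : Set ℝ, IsOpen U ∧ Set.Ici T ⊆ U ∧ ContMDiffOn (𝓘(ℝ, ℝ).prod (𝓡 4)) (𝓡 6) ∞ (fun q : ℝ × M => F q.1 q.2) (U ×ˢ Set.univ)) → (∀ t, T ≤ t → Manifold.IsSmoothEmbedding (𝓡 4) (𝓡 6) ∞ (F t)) → (∀ t,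 T ≤ t → ∀ x, ∑ i : Fin 5, F t x (Fin.castSucc i) ^ 2 = 1) → ∀ himm : (∀ t, T ≤ t → (Literature.Geometry.Riemannian.euclideanMetric (EuclideanSpace ℝ (Fin 6))).IsSpacelikeImmersion (𝓡 4) (F t)), (∀ t, T ≤ t → (Literature.Geometry.Riemannian.euclideanMetric (EuclideanSpace ℝ (Fin 6))).IsUnitNormal (𝓡 4) (F t) (ν t) 1) → (∀ t, T ≤ t → ∀ x, ∑ i : Fin 5, ν t x (Fin.castSucc i) * F t x (Fin.castSucc i) = 0) → (∀ t, T ≤ t → ContMDiff (𝓡 4) (𝓡 6) ∞ (ν t)) → (∀ t (ht : T ≤ t) (x : M), mfderiv 𝓘(ℝ, ℝ) (𝓡 6) (fun s => F s x) t (1 : ℝ) = -((Literature.Geometry.Riemannian.euclideanMetric (EuclideanSpace ℝ (Fin 6))).meanCurvature (F t) Literature.Geometry.Lorentzian.PseudoRiemannianMetric.contMDiff_pullbackBilin_holds (himm t ht) (ν t) x) • ν t x) → (∀ t, T ≤ t → (∃ R : ℝ, ∀ a b : EuclideanSpace ℝ (Fin 6), ∑ i : Fin 5, a (Fin.castSucc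 i) ^ 2 = 1 → ∑ i : Fin 5, b (Fin.castSucc i) ^ 2 = 1 → a 5 ≤ -R → R ≤ b 5 → ¬ JoinedIn ({z : EuclideanSpace ℝ (Fin 6) | ∑ i : Fin 5, z (Fin.castSucc i) ^ 2 = 1} \ Set.range (F t)) a b)) → (∀ t, T ≤ t → (⨆ (p : EuclideanSpace ℝ (Fin 6)) (_ : ∑ i : Fin 5, p (Fin.castSucc i) ^ 2 = 1) (τ : ℝ) (_ : 0 < τ), (μH[4] (Metric.sphere (0 : EuclideanSpace ℝ (Fin 5)) 1))⁻¹ * ∫⁻ z in Set.range (F t), ENNReal.ofReal ((∑' k : ℕ, Real.exp (-((k : ℝ) * ((k : ℝ) + 3)) * τ) * ((2 * (k : ℝ) + 3) / 3) * ∑ l ∈ Finset.range (k / 2 + 1), (-1 : ℝ) ^ l * (∏ j ∈ Finset.range (k - l), ((3 : ℝ) / 2 + (j : ℝ))) / (((l.factorial : ℕ) : ℝ) * (((k - 2 * l).factorial : ℕ) : ℝ)) * (2 * ∑ i : Fin 5, z (Fin.castSucc i) * p (Fin.castSucc i)) ^ (k - 2 * l)) * Real.exp (-((z 5 - p 5)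 ^ 2) / (4 * τ))) ∂μH[4]) < 2) → ∀ ε : ℝ, 0 < ε → ∃ t : ℝ, T ≤ t ∧ μH[4] (Set.range (F t)) ≤ ENNReal.ofReal (1 + ε) * μH[4] (Metric.sphere (0 : EuclideanSpace ℝ (Fin 5)) 1)) := by
  intro M _ _ _ _ _ _ _ F ν T hU hemb hN himm hun hνN hνs hvel hsep hent
  exact areaToFloor_of_areaNearFloorOfSmallTilt hstatic M F ν T ⟨hU, hemb, hN, himm, hun, hνN, hνs, hvel⟩
    hsep hent

end Summit.SmoothPoincare4.SmoothPoincare4.Theorems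

end
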